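import Summits.BirchSwinnertonDyer.BirchSwinnertonDyer.Theorems.KimAtThreeD7uUnramifiedMembership
import Summits.BirchSwinnertonDyer.BirchSwinnertonDyer.Theorems.KimAtThreeDeepUpperBadPlaceClause
import HarnessLib

/-!
# D7-u, `𝓕_u` form, on Kato's cyclotomic levels (any `p`): THEOREM D's local clause at a place
# `w ∉ r ∪ {p}` — anomalous bad `w` included — WITHOUT prime thinning, as the reduction of an UNRAMIFIED
# class of `H¹(ℚ_w, T_pE)` (cell `bsd-addord`, seat w2-tamdiv gen 2; route W2 `KimAtThreeKolyvagin`,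
# crux 19560 (C3) / TamDiv∞)

HONEST FRAMING: TOOL theorems (no definition, no named fact, no `sorry`); closes nothing by itself;
nothing is booked; BSD is not proved by any of this.  Companion of `KimAtThreeD7uUnramifiedMembership`
(§2 there = the `𝓕_u` END for abstract Euler-system levels `L`, every `p`): here the same statement is read
on the tree's cyclotomic levels `cyclotomicLevelsRat p S` (Kato's `ℚ(μ_{p^{n+1}}, μ_r)`, `r ∩ S = ∅`),
which are unramified at `w ∉ r` (`Derivative.Rat.subgroupIsUnramifiedAt_level_bot`), with THEOREM A's
generator data `N_ℓ = ℓ − 1` and the unramifiedness `hur` of the classes `c_{⊥,s}`, `s ⊆ r`, above `w` in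
the (C2)-shape of the tree's `ZetaBody` (restriction to `U_s ⊓ I_𝔓`; Kato (8.1.3), §8.2, Lemma 8.5) —
verbatim the binders of w2-c3's `KimAtThreeDeepUpperBadPlaceClause.localization_mem_propagatedSelmerStructure_of_res_eq_deriv_of_unramified`
with `3 ↦ p`:

* `exists_unramified_tateLocalMap_eq_localization_of_res_eq_deriv_of_unramified` — **`loc_w (Φ κ) = π_{k+1,*} y`
  with `y ∈ H¹(ℚ_w, T_pE)`, `res_{I_w} y = 0`** ([MR04] Remark A.5: `κ_r ∈ H¹_{(𝓕_u)_r}` at `w`), every `p`;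
* `localization_mem_propagatedSelmerStructure_of_res_eq_deriv_of_unramified` — w2-c3's `𝓕_can` conclusion
  `loc_w (Φ κ) ∈ propagatedSelmerStructure W p k (Sum.inr w)` with its «p = 3 only» HONEST LIMIT removed
  (no stable range on the `𝓕_u` road).

References: B. Mazur, K. Rubin, *Kolyvagin systems*, Mem. AMS 799 (2004), Def. 3.2.1, Thm. 3.2.4, App. A
Prop. A.2 and Remark A.5 (p. 81); K. Rubin, *Euler Systems* (2000), Lemma 1.3.2, Lemma 4.4.2, Thm. 4.5.1;
K. Kato, Astérisque 295 (2004), (8.1.3), §8.2, Lemma 8.5; K. Büyükboduk, J. Number Theory 129 (2009) Thm. 3.1.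
-/

noncomputable section

-- the cell's Theorems namespace `Summit.BirchSwinnertonDyer.BirchSwinnertonDyer.…` repeats the summit name by design (D-0017)
set_option linter.dupNamespace false

open CategoryTheory Function Finset Polynomial Field IsDedekindDomain NumberField
open scoped NumberField Classical
open Literature.NumberTheory.GaloisRepresentations Literature.NumberTheory.EllipticCurves
open WeierstrassCurve
open Summit.BirchSwinnertonDyer.Rank1Residual.GaloisImage
open Summit.BirchSwinnertonDyer.Rank1Residual.GaloisImage.CyclotomicLevel
open Summit.BirchSwinnertonDyer.Rank1Residual.GaloisImage.Derivative
open Summit.BirchSwinnertonDyer.Rank1Residual.GaloisImage.Derivative.Transverse.Rat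
open Summit.BirchSwinnertonDyer.BirchSwinnertonDyer.Theorems.KimAtThreeDeepUpperBadPlaceClause
open Summit.BirchSwinnertonDyer.BirchSwinnertonDyer.Theorems.KimAtThreeD7uUnramifiedMembership
open Rat.HeightOneSpectrum

namespace Summit.BirchSwinnertonDyer.BirchSwinnertonDyer.Theorems.KimAtThreeD7uUnramifiedMembershipCyclotomic

section Cyclotomic

variable (W : WeierstrassCurve ℚ) [W.IsElliptic] (p : ℕ) [Fact p.Prime] (k : ℕ)
variable [Module.Free ℤ_[p] (W.tateModule p)] [Module.Finite ℤ_[p] (W.tateModule p)]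
  [ContinuousSMul ℤ_[p] (W.tateModule p)]

/-- Local notation: `T∞ = T_p E` as a continuous `Γ_ℚ`-representation. -/
local notation3 "T∞" => WeierstrassCurve.tateGaloisRep W p (W.continuous_galoisRepTate_holds p)

variable {S : Set (HeightOneSpectrum (𝓞 ℚ))}

/-- Local notation: `𝓛` = Kato's cyclotomic levels `ℚ(μ_{p^{n+1}}, μ_r)`, `r ∩ S = ∅`. -/
local notation3 "𝓛" => cyclotomicLevelsRat p S

variable {M' : Type} [AddCommGroup M'] [Module ℤ_[p] M'] [TopologicalSpace M']
  [IsTopologicalAddGroup M'] [ContinuousSMul ℤ_[p] M'] {T' : GaloisRep ℚ ℤ_[p] M'}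

/-- **THEOREM D's local clause at a place `w ∉ r ∪ {p}`, `𝓕_u` form, every `p`** — on Kato's cyclotomic
levels `cyclotomicLevelsRat p S` (unramified at `w ∉ r`, `Derivative.Rat.subgroupIsUnramifiedAt_level_bot`),
with the generator data `N_ℓ = ℓ − 1` of THEOREM A and the unramifiedness `hur` of the classes `c_{⊥,s}`,
`s ⊆ r`, above `w` in the (C2)-shape of the tree's `ZetaBody` (restriction to `U_s ⊓ I_𝔓`):
**`loc_w (Φ κ) = π_{k+1,*} y` with `y ∈ H¹(ℚ_w, T_pE)` unramified.**  The binders are those of w2-c3's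
`KimAtThreeDeepUpperBadPlaceClause.localization_mem_propagatedSelmerStructure_of_res_eq_deriv_of_unramified`
with `3 ↦ p`. [cite: MazurRubin2004, Def. 3.2.1, Thm. 3.2.4 and App. A Remark A.5 (p. 81)]
[cite: Rubin2000, Lemma 4.4.2 and Thm. 4.5.1] [cite: Kato2004Asterisque, (8.1.3) (p. 180) and Lemma 8.5] -/
theorem exists_unramified_tateLocalMap_eq_localization_of_res_eq_deriv_of_unramified
    {c : ∀ (i : ℕ) (r : (𝓛).Ideals), H1 T∞ ((𝓛).level i r.1)} (hc : IsEulerSystem 𝓛 T∞ p c)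
    (red : (T∞).toTopRep ⟶ T'.toTopRep)
    (e : M' →+ WeierstrassCurve.geomTorsion W (((p : ℕ) : ℤ) ^ k * ((p : ℕ) : ℤ))) (hec : Continuous e)
    (he : ∀ (g : absoluteGaloisGroup ℚ) (x : M'),
      e (T' g x) = W.torsionGaloisModule (((p : ℕ) : ℤ) ^ k * ((p : ℕ) : ℤ)) g (e x))
    (hcomp : ∀ a : W.tateModule p, tateToTorsion W p k a = e (red.hom a))
    (Φ : continuousCohomology 1 T'.toTopRep →+
      galoisCohomology (W.torsionGaloisModule (((p : ℕ) : ℤ) ^ k * ((p : ℕ) : ℤ))) 1)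
    (hΦ : ∀ (φ : contOneCocycles T'.toTopRep)
      (ψ : contOneCocycles (W.torsionGaloisModule (((p : ℕ) : ℤ) ^ k * ((p : ℕ) : ℤ))).toTopRep),
      (∀ g, ψ.1 g = e (φ.1 g)) → Φ (oneCocycleClass _ φ) = oneCocycleClass _ ψ)
    (r : (𝓛).Ideals) (σ : HeightOneSpectrum (𝓞 ℚ) → absoluteGaloisGroup ℚ)
    (Fr : HeightOneSpectrum (𝓞 ℚ) → absoluteGaloisGroup ℚ)
    (hσ : ∀ ℓ ∈ r.1, ∀ q ∈ r.1, q ≠ ℓ → σ ℓ ∈ (𝓛).tameLevel q)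
    (hcov : ∀ ℓ ∈ r.1, ∀ g : absoluteGaloisGroup ℚ,
      ∃ j < ((primesEquiv ℓ : Nat.Primes) : ℕ) - 1, (σ ℓ ^ j)⁻¹ * g ∈ (𝓛).tameLevel ℓ)
    (hinj : ∀ ℓ ∈ r.1, ∀ j₁ < ((primesEquiv ℓ : Nat.Primes) : ℕ) - 1,
      ∀ j₂ < ((primesEquiv ℓ : Nat.Primes) : ℕ) - 1, (σ ℓ ^ j₁)⁻¹ * σ ℓ ^ j₂ ∈ (𝓛).tameLevel ℓ → j₁ = j₂)
    (hFr : ∀ ℓ ∈ r.1, IsArithFrobAtPlace ℚ ℓ (Fr ℓ))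
    (hram : ∀ ℓ ∈ r.1, ∀ s ⊆ r.1, ℓ ∉ s → ¬ SubgroupIsUnramifiedAt ℚ ((𝓛).level ⊥ (insert ℓ s)) ℓ)
    (hM₁ : ∀ ℓ ∈ r.1, ∀ v : M', ((((primesEquiv ℓ : Nat.Primes) : ℕ) - 1 : ℕ) : ℤ_[p]) • v = 0)
    (hM₂ : ∀ ℓ ∈ r.1, ∀ v : M',
      (rubinEulerFactor (T∞).toRepresentation (cyclotomicCharacterToUnits ℚ p ℤ_[p]) (Fr ℓ)).eval 1 •
        v = 0)
    (comm)
    (h0 : ∀ v : T'.toTopRep,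
      (∀ u : (𝓛).level ⊥ r.1, T'.toTopRep.ρ (u : absoluteGaloisGroup ℚ) v = v) → v = 0)
    (κ : continuousCohomology 1 T'.toTopRep)
    (hκ : resSubgroup T'.toTopRep ((𝓛).level ⊥ r.1) 1 κ =
        (r.1.noncommProd (fun ℓ => ∑ j ∈ range (((primesEquiv ℓ : Nat.Primes) : ℕ) - 1),
          (j : Module.End ℤ_[p] (continuousCohomology 1 (subgroupRep T'.toTopRep ((𝓛).level ⊥ r.1)))) *
          (conjMap T'.toTopRep ((𝓛).level ⊥ r.1) (σ ℓ) 1).hom.toLinearMap ^ j) comm)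
        (ContinuousCohomology.map (ContinuousMonoidHom.id _)
          (X := subgroupRep (T∞).toTopRep ((𝓛).level ⊥ r.1))
          (Y := subgroupRep T'.toTopRep ((𝓛).level ⊥ r.1))
          ((TopRep.resFunctor ((𝓛).level ⊥ r.1).subtype).map red) 1 (c ⊥ r)))
    (w : HeightOneSpectrum (𝓞 ℚ)) (hw : w ∉ r.1)
    (hur : ∀ (s : Finset (HeightOneSpectrum (𝓞 ℚ))) (hs : s ⊆ r.1)
      (𝔓 : Ideal (absIntegers (𝓞 ℚ) ℚ)), 𝔓 ∈ w.primesAbove →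
      resLe (T∞).toTopRep
        (inf_le_left : (𝓛).level ⊥ s ⊓ 𝔓.inertia (absoluteGaloisGroup ℚ) ≤ (𝓛).level ⊥ s) 1
        (c ⊥ ⟨s, fun q hq => r.2 q (hs hq)⟩) = 0) :
    ∃ y : (tateLocalRep W p (Sum.inr w)).cohomology 1,
      resSubgroup (tateLocalRep W p (Sum.inr w)).toTopRep (absInertia (w.adicCompletion ℚ)) 1 y = 0 ∧
        tateLocalMap W p k (Sum.inr w) y =
          galoisCohomology.localization (W.torsionGaloisModule (((p : ℕ) : ℤ) ^ k * ((p : ℕ) : ℤ)))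
            (Sum.inr w) 1 (Φ κ) := by
  -- the level is unramified at `w ∉ r`
  have hwU : SubgroupIsUnramifiedAt ℚ ((cyclotomicLevelsRat p S).level ⊥ r.1) w :=
    Derivative.Rat.subgroupIsUnramifiedAt_level_bot p S r.1 hw
  -- the `𝓕_u` END; (C2) at the sub-levels `s ⊆ r` in THEOREM B-u's form
  refine exists_unramified_tateLocalMap_eq_localization_of_unramified W p hc red k e hec he hcomp Φ hΦ r
    σ (fun ℓ => ((primesEquiv ℓ : Nat.Primes) : ℕ) - 1) Fr hσ hcov hinj hFr hram hM₁ hM₂ comm h0 κ hκ w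
    hwU fun s hs 𝔓 h𝔓 => ?_
  rw [resLe_resLe]
  exact resLe_eq_zero_of_resLe_inf_eq_zero (T∞).toTopRep _ _ (hur s hs 𝔓 h𝔓)

/-- **THEOREM D's local clause at a place `w ∉ r ∪ {p}` — bad `w` with `E(ℚ_w)[p] ≠ 0` INCLUDED — with
NO condition on the primes of `r`, for EVERY `p`**: w2-c3's
`KimAtThreeDeepUpperBadPlaceClause.localization_mem_propagatedSelmerStructure_of_res_eq_deriv_of_unramified`
with its «p = 3 only» limit removed: `loc_w (Φ κ) ∈ propagatedSelmerStructure W p k (Sum.inr w)`.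
[cite: MazurRubin2004, Def. 3.2.1, Thm. 3.2.4 and App. A Remark A.5 (p. 81)]
[cite: Rubin2000, Lemma 4.4.2 and Thm. 4.5.1] [cite: Kato2004Asterisque, (8.1.3) (p. 180) and Lemma 8.5] -/
theorem localization_mem_propagatedSelmerStructure_of_res_eq_deriv_of_unramified
    {c : ∀ (i : ℕ) (r : (𝓛).Ideals), H1 T∞ ((𝓛).level i r.1)} (hc : IsEulerSystem 𝓛 T∞ p c)
    (red : (T∞).toTopRep ⟶ T'.toTopRep)
    (e : M' →+ WeierstrassCurve.geomTorsion W (((p : ℕ) : ℤ) ^ k * ((p : ℕ) : ℤ))) (hec : Continuous e)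
    (he : ∀ (g : absoluteGaloisGroup ℚ) (x : M'),
      e (T' g x) = W.torsionGaloisModule (((p : ℕ) : ℤ) ^ k * ((p : ℕ) : ℤ)) g (e x))
    (hcomp : ∀ a : W.tateModule p, tateToTorsion W p k a = e (red.hom a))
    (Φ : continuousCohomology 1 T'.toTopRep →+
      galoisCohomology (W.torsionGaloisModule (((p : ℕ) : ℤ) ^ k * ((p : ℕ) : ℤ))) 1)
    (hΦ : ∀ (φ : contOneCocycles T'.toTopRep)
      (ψ : contOneCocycles (W.torsionGaloisModule (((p : ℕ) : ℤ) ^ k * ((p : ℕ) : ℤ))).toTopRep),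
      (∀ g, ψ.1 g = e (φ.1 g)) → Φ (oneCocycleClass _ φ) = oneCocycleClass _ ψ)
    (r : (𝓛).Ideals) (σ : HeightOneSpectrum (𝓞 ℚ) → absoluteGaloisGroup ℚ)
    (Fr : HeightOneSpectrum (𝓞 ℚ) → absoluteGaloisGroup ℚ)
    (hσ : ∀ ℓ ∈ r.1, ∀ q ∈ r.1, q ≠ ℓ → σ ℓ ∈ (𝓛).tameLevel q)
    (hcov : ∀ ℓ ∈ r.1, ∀ g : absoluteGaloisGroup ℚ,
      ∃ j < ((primesEquiv ℓ : Nat.Primes) : ℕ) - 1, (σ ℓ ^ j)⁻¹ * g ∈ (𝓛).tameLevel ℓ)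
    (hinj : ∀ ℓ ∈ r.1, ∀ j₁ < ((primesEquiv ℓ : Nat.Primes) : ℕ) - 1,
      ∀ j₂ < ((primesEquiv ℓ : Nat.Primes) : ℕ) - 1, (σ ℓ ^ j₁)⁻¹ * σ ℓ ^ j₂ ∈ (𝓛).tameLevel ℓ → j₁ = j₂)
    (hFr : ∀ ℓ ∈ r.1, IsArithFrobAtPlace ℚ ℓ (Fr ℓ))
    (hram : ∀ ℓ ∈ r.1, ∀ s ⊆ r.1, ℓ ∉ s → ¬ SubgroupIsUnramifiedAt ℚ ((𝓛).level ⊥ (insert ℓ s)) ℓ)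
    (hM₁ : ∀ ℓ ∈ r.1, ∀ v : M', ((((primesEquiv ℓ : Nat.Primes) : ℕ) - 1 : ℕ) : ℤ_[p]) • v = 0)
    (hM₂ : ∀ ℓ ∈ r.1, ∀ v : M',
      (rubinEulerFactor (T∞).toRepresentation (cyclotomicCharacterToUnits ℚ p ℤ_[p]) (Fr ℓ)).eval 1 •
        v = 0)
    (comm)
    (h0 : ∀ v : T'.toTopRep,
      (∀ u : (𝓛).level ⊥ r.1, T'.toTopRep.ρ (u : absoluteGaloisGroup ℚ) v = v) → v = 0)
    (κ : continuousCohomology 1 T'.toTopRep)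
    (hκ : resSubgroup T'.toTopRep ((𝓛).level ⊥ r.1) 1 κ =
        (r.1.noncommProd (fun ℓ => ∑ j ∈ range (((primesEquiv ℓ : Nat.Primes) : ℕ) - 1),
          (j : Module.End ℤ_[p] (continuousCohomology 1 (subgroupRep T'.toTopRep ((𝓛).level ⊥ r.1)))) *
          (conjMap T'.toTopRep ((𝓛).level ⊥ r.1) (σ ℓ) 1).hom.toLinearMap ^ j) comm)
        (ContinuousCohomology.map (ContinuousMonoidHom.id _)
          (X := subgroupRep (T∞).toTopRep ((𝓛).level ⊥ r.1))
          (Y := subgroupRep T'.toTopRep ((𝓛).level ⊥ r.1))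
          ((TopRep.resFunctor ((𝓛).level ⊥ r.1).subtype).map red) 1 (c ⊥ r)))
    (w : HeightOneSpectrum (𝓞 ℚ)) (hw : w ∉ r.1)
    (hur : ∀ (s : Finset (HeightOneSpectrum (𝓞 ℚ))) (hs : s ⊆ r.1)
      (𝔓 : Ideal (absIntegers (𝓞 ℚ) ℚ)), 𝔓 ∈ w.primesAbove →
      resLe (T∞).toTopRep
        (inf_le_left : (𝓛).level ⊥ s ⊓ 𝔓.inertia (absoluteGaloisGroup ℚ) ≤ (𝓛).level ⊥ s) 1
        (c ⊥ ⟨s, fun q hq => r.2 q (hs hq)⟩) = 0) :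
    galoisCohomology.localization (W.torsionGaloisModule (((p : ℕ) : ℤ) ^ k * ((p : ℕ) : ℤ))) (Sum.inr w) 1
        (Φ κ) ∈ propagatedSelmerStructure W p k (Sum.inr w) :=
  mem_propagatedSelmerStructure_of_exists_tateLocalMap_eq W p k w
    (exists_unramified_tateLocalMap_eq_localization_of_res_eq_deriv_of_unramified W p k hc red e hec he hcomp
      Φ hΦ r σ Fr hσ hcov hinj hFr hram hM₁ hM₂ comm h0 κ hκ w hw hur)

end Cyclotomic

end Summit.BirchSwinnertonDyer.BirchSwinnertonDyer.Theorems.KimAtThreeD7uUnramifiedMembershipCyclotomic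

end
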